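import Summits.AtomisticToContinuum.BoseEinsteinCondensation.Theorems.BECInsertionCorrectorCorrectorClosureRemovalEnergyBudgetRemoval
import Summits.AtomisticToContinuum.BoseEinsteinCondensation.Theorems.BECConjugateDominationPositiveMinimiserFinal
import Literature.MathematicalPhysics.QuantumManyBody.PeriodicBoseGasImpurityTranslation
import HarnessLib

/-!
# The zero-mode f-sum bound, I: calculus of the cell average in the tagged slot
# (line `volume-homotopy-sum-rule-domination`, helpers for the registered stub `stub_zeroModeFSum`,
# crux `BECInsertionCorrector.CorrectorClosure`, item stmt-AtomisticToContinuum-12058)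

Supports (does not close) stmt-AtomisticToContinuum-12058. For a function `b` on `(ℝ³)^{M+1}` we
write `B = P₀b` for its CELL AVERAGE in particle `0`,
`B(Y) = L⁻³ ∫_{[0,L)³} b(x, Y) dx` (a function on the bath `(ℝ³)^M`; as an operator on
`L²(cell^{M+1})`, `b ↦ B∘tail` is the orthogonal projection `P₀ = |φ₀⟩⟨φ₀| ⊗ 1` onto the constant
mode of particle `0`). This file is the slot-`0` toolkit of the zero-mode f-sum bound
(`…ZeroModeFSum.lean`), stated with the average as a hypothesis
`hB : ∀ Y, B Y = (L ^ 3)⁻¹ * ∫ x in cell L, b (vecCons x Y)` (no new definitions):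

* `zf_update_zero`: `update X 0 y = (y, tail X)`; `zf_setIntegral_cell_const`, `zf_avg_of_tail`,
  `zf_avg_of_sum` (cell averages of bath functions and of sums, in hypothesis form);
* `zf_avg_isPeriodicTest`, `zf_avg_pderiv`: the average of a periodic test function is a periodic
  test function on the bath and `∂_{j,k} P₀ b = P₀ ∂_{j+1,k} b` (differentiation under the cell
  integral, from `isPeriodicTest_modeCoeff` / `pderiv_modeCoeff`);
* `zf_integral_tail_mul`: `∫_{cell^{M+1}} a(tail X) b(X) dX = L³ ∫_{cell^M} a · P₀b` — the symmetry
  `⟨a∘tail, b⟩ = ⟨a∘tail, (P₀b)∘tail⟩` of the projection (Fubini, tagged coordinate innermost);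
* `zf_integral_gradDot_tail`: `∫ ∇(a∘tail)·∇b = L³ ∫ ∇a·∇(P₀b)` — the kinetic energy commutes with
  `P₀` (`[T, P₀] = 0` in weak form: `∂_0(a∘tail) = 0` and `∂_{j+1}` passes under the average);
* `zf_integral_pot_tail`: `∫ v^per(x₀ − c(tail X)) a(tail X) dX = ‖v‖₁ ∫ a`, `‖v‖₁ = ∫_{ℝ³} v(|y|)dy`
  (the cell integral of the periodisation, `lintegral_cell_periodizedPotential_sub`) — the identity
  `P₀ v^per(x₀ − x_l) P₀ = L⁻³‖v‖₁ P₀`;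
* `zf_integral_avg_sq_le`: `∫ (P₀b∘tail)² ≤ ∫ b²` (`‖P₀‖ ≤ 1`, by `⟨P₀b, P₀b⟩ = ⟨P₀b, b⟩` and AM–GM);
* `zf_integral_update_update_swap`: Fubini for two cell integrals in two slots (`[P_i, P_j] = 0`).

References: [Stringari1995] S. Stringari, *Sum rules and Bose–Einstein condensation*, §2.3;
[PitaevskiiStringari1991] L. Pitaevskii, S. Stringari, *Uncertainty principle, quantum
fluctuations, and broken symmetries*, J. Low Temp. Phys. 85 (1991), (9).
-/

noncomputable section

namespace Summit.AtomisticToContinuum.BoseEinsteinCondensation.Theorems.CorrectorClosure.VolumeHomotopySumRuleDomination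

open MeasureTheory Filter Matrix
open scoped ENNReal NNReal BigOperators
open Literature.MathematicalPhysics.QuantumManyBody.BoseGas
open Summit.AtomisticToContinuum.BoseEinsteinCondensation.Theorems.CorrectorClosure.GeometricMeanCorrector
  (tilt_gradDot_tail_vecCons tilt_pderiv_vecCons_slice tilt_contDiff_comp_tail mixedLaw_tail_vecCons
    mixedLaw_continuous_tail)
open Summit.AtomisticToContinuum.BoseEinsteinCondensation.Theorems.CorrectorClosure.HealingScaleKacInsertion
  (isPeriodicTest_modeCoeff pderiv_modeCoeff)
open Summit.AtomisticToContinuum.BoseEinsteinCondensation.Theorems.PositiveMinimiser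
  (periodizedPotential_ne_top)

variable {M : ℕ} {L : ℝ}

/-! ### Elementary identities on the cell -/

/-- Moving particle `0` of `X` to `y` is consing `y` onto the bath: `update X 0 y = (y, tail X)`.
[folklore] -/
theorem zf_update_zero (X : Config (M + 1)) (y : Space) :
    Function.update X 0 y = vecCons y (Fin.tail X) := by
  conv_lhs => rw [← Fin.cons_self_tail X]
  exact Fin.update_cons_zero (X 0) (Fin.tail X) y

/-- `∫_{[0,L)³} c dx = L³ c` for `L ≥ 0`. [folklore] -/
theorem zf_setIntegral_cell_const (hL : 0 ≤ L) (c : ℝ) : ∫ _x in cell L, c = L ^ 3 * c := by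
  rw [setIntegral_const, smul_eq_mul, Measure.real, volume_cell, ENNReal.toReal_pow,
    ENNReal.toReal_ofReal hL]

/-- The cell average of a bath function is the function: `L⁻³ ∫_{[0,L)³} a(tail (x, Y)) dx = a(Y)`,
in the hypothesis form used throughout. [folklore] -/
theorem zf_avg_of_tail (hL : 0 < L) (a : Config M → ℝ) (Y : Config M) :
    a Y = (L ^ 3)⁻¹ * ∫ x in cell L, (fun X : Config (M + 1) => a (Fin.tail X)) (vecCons x Y) := by
  simp only [mixedLaw_tail_vecCons]
  rw [zf_setIntegral_cell_const hL.le]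
  field_simp

/-- The cell average of a finite sum is the sum of the cell averages, in hypothesis form (continuous
summands). [folklore] -/
theorem zf_avg_of_sum {ι : Type*} (s : Finset ι) {b : ι → Config (M + 1) → ℝ}
    (hb : ∀ i ∈ s, Continuous (b i)) {B : ι → Config M → ℝ}
    (hB : ∀ i ∈ s, ∀ Y, B i Y = (L ^ 3)⁻¹ * ∫ x in cell L, b i (vecCons x Y)) (Y : Config M) :
    ∑ i ∈ s, B i Y =
      (L ^ 3)⁻¹ * ∫ x in cell L, (fun X : Config (M + 1) => ∑ i ∈ s, b i X) (vecCons x Y) := by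
  have hint : ∀ i ∈ s, Integrable (fun x : Space => b i (vecCons x Y)) (volume.restrict (cell L)) :=
    fun i hi => integrableOn_cell ((hb i hi).comp (continuous_id.matrixVecCons continuous_const))
  simp only
  rw [integral_finsetSum _ hint, Finset.mul_sum]
  exact Finset.sum_congr rfl fun i hi => hB i hi Y

/-! ### The cell average of a periodic test function -/

/-- **`P₀` of a periodic test function is a periodic test function on the bath.** [folklore] -/
theorem zf_avg_isPeriodicTest (hL : 0 < L) {b : Config (M + 1) → ℝ} (hb : IsPeriodicTest L b)
    {B : Config M → ℝ} (hB : ∀ Y, B Y = (L ^ 3)⁻¹ * ∫ x in cell L, b (vecCons x Y)) :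
    IsPeriodicTest L B := by
  have h := isPeriodicTest_modeCoeff (N := M) hL hb (w := fun _ : Space => (L ^ 3)⁻¹) continuous_const
  rw [show B = fun Y => ∫ x in cell L, (L ^ 3)⁻¹ * b (vecCons x Y) from
    funext fun Y => by rw [hB, integral_const_mul]]
  exact h

/-- **Differentiation under the cell average**: `∂_{j,k} P₀b = P₀ ∂_{j+1,k} b`. [folklore] -/
theorem zf_avg_pderiv (hL : 0 < L) {b : Config (M + 1) → ℝ} (hb : IsPeriodicTest L b)
    {B : Config M → ℝ} (hB : ∀ Y, B Y = (L ^ 3)⁻¹ * ∫ x in cell L, b (vecCons x Y)) (Y : Config M)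
    (j : Fin M) (k : Fin 3) :
    pderiv j k B Y = (L ^ 3)⁻¹ * ∫ x in cell L, pderiv j.succ k b (vecCons x Y) := by
  rw [show B = fun Y => ∫ x in cell L, (L ^ 3)⁻¹ * b (vecCons x Y) from
    funext fun Y => by rw [hB, integral_const_mul]]
  rw [pderiv_modeCoeff hL hb continuous_const Y j k, integral_const_mul]

/-! ### Fubini with a bath factor: the symmetry of `P₀` -/

/-- **Symmetry of the cell average.** For continuous `a` on the bath and `b` on `(ℝ³)^{M+1}`:
`∫_{cell^{M+1}} a(tail X) b(X) dX = L³ ∫_{cell^M} a(Y) (P₀b)(Y) dY`. [folklore] -/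
theorem zf_integral_tail_mul (hL : 0 < L) {a : Config M → ℝ} (ha : Continuous a)
    {b : Config (M + 1) → ℝ} (hb : Continuous b) {B : Config M → ℝ}
    (hB : ∀ Y, B Y = (L ^ 3)⁻¹ * ∫ x in cell L, b (vecCons x Y)) :
    ∫ X in cellN (M + 1) L, a (Fin.tail X) * b X = L ^ 3 * ∫ Y in cellN M L, a Y * B Y := by
  have hc : Continuous fun X : Config (M + 1) => a (Fin.tail X) * b X :=
    (ha.comp mixedLaw_continuous_tail).mul hb
  rw [setIntegral_cellN_succ_right_of_continuous hc, ← integral_const_mul]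
  refine integral_congr_ae (ae_of_all _ fun Y => ?_)
  simp only [mixedLaw_tail_vecCons]
  rw [integral_const_mul, hB Y]
  field_simp

/-- **The kinetic pairing commutes with the cell average** (`[T, P₀] = 0`, weak form): for `a ∈ C¹`
on the bath and a periodic test function `b`,
`∫_{cell^{M+1}} ∇(a∘tail)·∇b = L³ ∫_{cell^M} ∇a·∇(P₀b)`. [folklore] -/
theorem zf_integral_gradDot_tail (hL : 0 < L) {a : Config M → ℝ} (ha : ContDiff ℝ 1 a)
    {b : Config (M + 1) → ℝ} (hb : IsPeriodicTest L b) {B : Config M → ℝ}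
    (hB : ∀ Y, B Y = (L ^ 3)⁻¹ * ∫ x in cell L, b (vecCons x Y)) :
    ∫ X in cellN (M + 1) L, gradDot (fun W => a (Fin.tail W)) b X =
      L ^ 3 * ∫ Y in cellN M L, gradDot a B Y := by
  -- adapted from `reb_integral_cell_gradDot_slice` (RemovalEnergyBudgetRemoval)
  have haT : ContDiff ℝ 1 fun W : Config (M + 1) => a (Fin.tail W) := tilt_contDiff_comp_tail ha
  have hc : Continuous (gradDot (fun W => a (Fin.tail W)) b) := continuous_gradDot haT hb.1
  rw [setIntegral_cellN_succ_right_of_continuous hc, ← integral_const_mul]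
  refine integral_congr_ae (ae_of_all _ fun Y => ?_)
  have had : Differentiable ℝ a := ha.differentiable one_ne_zero
  have hbd : Differentiable ℝ b := hb.differentiable
  have hpt : ∀ x : Space, gradDot (fun W => a (Fin.tail W)) b (vecCons x Y) =
      ∑ j : Fin M, ∑ k : Fin 3, pderiv j k a Y * pderiv j.succ k b (vecCons x Y) := by
    intro x
    rw [tilt_gradDot_tail_vecCons had hbd x Y]
    simp only [gradDot]
    refine Finset.sum_congr rfl fun j _ => Finset.sum_congr rfl fun k _ => ?_
    rw [tilt_pderiv_vecCons_slice hbd x Y j k]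
  have hcont : ∀ (j : Fin M) (k : Fin 3),
      Continuous fun x : Space => pderiv j.succ k b (vecCons x Y) :=
    fun j k => (continuous_pderiv hb.1 _ _).comp (continuous_id.matrixVecCons continuous_const)
  have hint : ∀ (j : Fin M) (k : Fin 3),
      Integrable (fun x : Space => pderiv j k a Y * pderiv j.succ k b (vecCons x Y))
        (volume.restrict (cell L)) :=
    fun j k => (integrableOn_cell (hcont j k)).const_mul _
  dsimp only
  simp_rw [hpt]
  rw [integral_finsetSum _ fun j _ => integrable_finsetSum _ fun k _ => hint j k, gradDot,
    Finset.mul_sum]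
  refine Finset.sum_congr rfl fun j _ => ?_
  rw [integral_finsetSum _ fun k _ => hint j k, Finset.mul_sum]
  refine Finset.sum_congr rfl fun k _ => ?_
  rw [integral_const_mul, zf_avg_pderiv hL hb hB Y j k]
  field_simp

/-! ### The cell integral of the periodised potential -/

/-- **`P₀ v^per(x₀ − x_l) P₀ = L⁻³ ‖v‖₁ P₀`.** For a finite finite-range measurable profile `v` with
continuous periodisation, a continuous bath function `a` and a continuous choice `c(Y)` of the partner
position: `∫_{cell^{M+1}} v^per(x₀ − c(tail X)) a(tail X) dX = ‖v‖₁ ∫_{cell^M} a`,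
`‖v‖₁ = ∫_{ℝ³} v(|y|) dy` (the cell tiles `ℝ³` under the period lattice). [folklore] -/
theorem zf_integral_pot_tail (hL : 0 < L) {v : ℝ → ℝ≥0∞} (hv : Measurable v) {R₀ : ℝ}
    (hR : ∀ r, R₀ < r → v r = 0) (hfin : ∀ r, v r ≠ ⊤)
    (hvc : Continuous fun x : Space => (periodizedPotential v L x).toReal)
    {a : Config M → ℝ} (ha : Continuous a) {c : Config M → Space} (hc : Continuous c) :
    ∫ X in cellN (M + 1) L, (periodizedPotential v L (X 0 - c (Fin.tail X))).toReal * a (Fin.tail X) =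
      (∫⁻ y : Space, v ‖y‖).toReal * ∫ Y in cellN M L, a Y := by
  have hcont : Continuous fun X : Config (M + 1) =>
      (periodizedPotential v L (X 0 - c (Fin.tail X))).toReal * a (Fin.tail X) :=
    (hvc.comp ((continuous_apply 0).sub (hc.comp mixedLaw_continuous_tail))).mul
      (ha.comp mixedLaw_continuous_tail)
  rw [setIntegral_cellN_succ_right_of_continuous hcont, ← integral_const_mul]
  refine integral_congr_ae (ae_of_all _ fun Y => ?_)
  simp only [mixedLaw_tail_vecCons, cons_val_zero]
  rw [integral_mul_const]
  congr 1
  have hmeas : AEMeasurable (fun x : Space => periodizedPotential v L (x - c Y))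
      (volume.restrict (cell L)) :=
    ((measurable_periodizedPotential hv L).comp (measurable_id.sub_const _)).aemeasurable
  rw [integral_toReal hmeas (ae_of_all _ fun x => lt_top_iff_ne_top.2
    (periodizedPotential_ne_top hL hR hfin _)), lintegral_cell_periodizedPotential_sub hL hv (c Y)]

/-! ### `‖P₀‖ ≤ 1` -/

/-- **The cell average does not increase the mean square**: `∫_{cell^{M+1}} (P₀b∘tail)² ≤ ∫ b²`
(`⟨P₀b, P₀b⟩ = ⟨P₀b, b⟩ ≤ ½⟨P₀b, P₀b⟩ + ½⟨b, b⟩`). [folklore] -/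
theorem zf_integral_avg_sq_le (hL : 0 < L) {b : Config (M + 1) → ℝ} (hb : Continuous b)
    {B : Config M → ℝ} (hBc : Continuous B)
    (hB : ∀ Y, B Y = (L ^ 3)⁻¹ * ∫ x in cell L, b (vecCons x Y)) :
    ∫ X in cellN (M + 1) L, B (Fin.tail X) ^ 2 ≤ ∫ X in cellN (M + 1) L, b X ^ 2 := by
  have hBt : Continuous fun X : Config (M + 1) => B (Fin.tail X) := hBc.comp mixedLaw_continuous_tail
  have h1 : ∫ X in cellN (M + 1) L, B (Fin.tail X) ^ 2 = L ^ 3 * ∫ Y in cellN M L, B Y * B Y := by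
    have h := zf_integral_tail_mul hL hBc (b := fun X => B (Fin.tail X)) hBt (zf_avg_of_tail hL B)
    simpa only [sq] using h
  have h2 : ∫ X in cellN (M + 1) L, B (Fin.tail X) * b X = L ^ 3 * ∫ Y in cellN M L, B Y * B Y :=
    zf_integral_tail_mul hL hBc hb hB
  have h3 : ∫ X in cellN (M + 1) L, B (Fin.tail X) * b X ≤
      ∫ X in cellN (M + 1) L, (B (Fin.tail X) ^ 2 + b X ^ 2) / 2 :=
    integral_mono (integrableOn_cellN (hBt.mul hb) L)
      (integrableOn_cellN (((hBt.pow 2).add (hb.pow 2)).div_const 2) L) fun X => by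
        dsimp only
        nlinarith [sq_nonneg (B (Fin.tail X) - b X)]
  have h4 : ∫ X in cellN (M + 1) L, (B (Fin.tail X) ^ 2 + b X ^ 2) / 2 =
      ((∫ X in cellN (M + 1) L, B (Fin.tail X) ^ 2) + ∫ X in cellN (M + 1) L, b X ^ 2) / 2 := by
    have iB : IntegrableOn (fun X : Config (M + 1) => B (Fin.tail X) ^ 2) (cellN (M + 1) L) :=
      integrableOn_cellN (hBt.pow 2) L
    have ib : IntegrableOn (fun X : Config (M + 1) => b X ^ 2) (cellN (M + 1) L) :=
      integrableOn_cellN (hb.pow 2) L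
    rw [integral_div, integral_add iB ib]
  have h5 : ∫ X in cellN (M + 1) L, B (Fin.tail X) ^ 2 = ∫ X in cellN (M + 1) L, B (Fin.tail X) * b X := by
    rw [h1, h2]
  rw [h4] at h3
  linarith

/-! ### Two cell averages commute -/

/-- **Fubini for two slots**: for a continuous bounded `b` and two slots `i, j`,
`∫_cell ∫_cell b(X; xᵢ ↦ x, xⱼ ↦ y) dy dx = ∫_cell ∫_cell b(X; xᵢ ↦ x, xⱼ ↦ y) dx dy`
(`[Pᵢ, Pⱼ] = 0`). [folklore] -/
theorem zf_integral_update_update_swap {K : ℕ} (L : ℝ) {b : Config K → ℝ} (hb : Continuous b)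
    {C : ℝ} (hC : ∀ X, |b X| ≤ C) (X : Config K) (i j : Fin K) :
    ∫ x in cell L, ∫ y in cell L, b (Function.update (Function.update X i x) j y) =
      ∫ y in cell L, ∫ x in cell L, b (Function.update (Function.update X i x) j y) := by
  haveI : IsFiniteMeasure ((volume : Measure Space).restrict (cell L)) :=
    isFiniteMeasure_restrict.2 (by rw [volume_cell]; exact ENNReal.pow_ne_top ENNReal.ofReal_ne_top)
  refine integral_integral_swap ?_
  have hcont : Continuous fun p : Space × Space =>
      b (Function.update (Function.update X i p.1) j p.2) :=
    hb.comp (((continuous_const : Continuous fun _ : Space × Space => X).update i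
      continuous_fst).update j continuous_snd)
  refine Integrable.mono' (integrable_const C) hcont.aestronglyMeasurable (ae_of_all _ fun p => ?_)
  rw [Real.norm_eq_abs]
  exact hC _

end Summit.AtomisticToContinuum.BoseEinsteinCondensation.Theorems.CorrectorClosure.VolumeHomotopySumRuleDomination

end
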